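import Literature.MathematicalPhysics.QuantumFieldTheory.Balaban1983to89.Node00.LinearisedAveragingShear

/-!
# NODE 00 — THE INFINITESIMAL GAUGE COVARIANCE OF THE LINEARISED `k`-FOLD AVERAGING `Q_k(U₀)`:
# `Q_k(U)(∇_U λ) = ∇_{Ū^k(U)}(λ ∘ emb^k)`, and the infinitesimal RESIDUAL gauge transformations lie in `ker Q_k(U)`
# (module D4-inf of the [15] Sect. B audit of seat `pub-ymgap-dag-n07-w1`; generation 5, CLAIM-1 ∕ INTENT-1)

Cell `pub-ymgap`, width seat `pub-ymgap-dag-n07-w1` generation 5 (DAG node N07 = [15] = [Balaban1985Variational]).  NEW leaf, THEOREMS ONLY,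
`--kind proof --supports stmt-QuantumFields-20542` (K1⁷), count-neutral.  CONSUMED BY NAME, nothing modified: 35a `Node00.CriticalOnFibreTangent`
(`expSU_zero`, `hasDerivAt_coe_expSU_along`), 35b `Node00.AveragingSmooth` (`coeField`, `iterM`, `SmallBelow`, `contDiffAt_iterM`, `coeField_iter_eq_iterM`,
`coeField_avgFamily_eq_iterM`), this seat's g0 `Node00.LinearisedAveragingAtBackground` (`dIterL` = `Q_k`, `qLin`, `qLin_apply`), g0 `Node00.LinearisedAveragingFlat`
(`hasFDerivAt_iterM_one`, `iterM_apply_one`, `qLin_one_apply`), g4 `Node00.LinearisedAveragingEquivariant` (`fieldConj`, ★ `iterM_fieldConj` — the GUARD-FREE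
two-sided equivariance `iterM k (C_u V) = C_{u↾k}(iterM k V)`), g4 `Node00.LinearisedAveragingShear` (`hasDerivAt_fieldConj_family_of_one` — the product rule for a
moving conjugation through `1`), `Node00.WilsonActionSecondVariation` (`coe_inv_SU`, `coe_mul_star_coe_SU`, `star_coe_mul_coe_mul_SU`), `B16Sect1Backgrounds.toMS`,
`T4AdjointCovarianceUnitary` (`lieSU`, `expSU`, `specialUnitaryAd`, `coe_specialUnitaryAd`).

THE PRINT.  [Balaban1985Averaging] (8) p. 18 (`U^u(x,x′) = u(x)U(x,x′)u⁻¹(x′)`), (11) p. 19 (`Ū^u = (Ū)^ū`, `ū(y) = u(y)` at the block centres `y ∈ T₁^{(1)} ⊂ T₁`);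
[Balaban1985Variational] (3)–(5) p. 278 (the averages and their gauge covariance), (44) p. 285 (`Q_j(U₀)`, the linearisation of the `j`-fold average at the background),
(82)–(83) p. 290 (criticality tested on the kernel of the linearised averaging; gauge directions), p. 284 («gauge transformations `u` … equal to `1` on `T₁^{(k)}`» — the
residual gauge group fixing the averages); [Balaban1985RegularSpaces] (1.15) p. 78 (the residual gauge freedom of the axial gauge);
[Balaban1985BackgroundPropagators] (3.1)–(3.2) p. 390, (3.29) p. 395 (`U′ = U₀ exp(iηA)`, `D_{U₀}λ`, `R(u)` on Lie-algebra fields).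

WHY THIS FILE (g4's HANDOFF, D4 lane completion).  The tree holds the covariance of `Q_k` when background AND field are conjugated by the SAME `u`
(`dIterL_fieldConj_comp`, `qLin_gaugeAct_of_all`) and the velocity of an OUTPUT-side shear (`hasDerivAt_fieldConj_iterM_family`).  The INPUT-side infinitesimal
statement — what `Q_k(U)` does to the tangent vector of the gauge orbit through `U` itself — is the `t`-derivative at `t = 0` of g4's guard-free identity
`iterM k (C_{u(t)} ↑U) = C_{u(t)↾k}(iterM k ↑U)` along `u(t)(x) = exp(t·λ(x))`, `λ : sites → 𝔰𝔲(N)`: the left side differentiates to `Q_k(↑U)` applied to the chart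
direction `b ↦ λ(b₋)·U_b − U_b·λ(b₊)` of the infinitesimal gauge transformation (= `U_b·(Ad(U_b⁻¹)λ(b₋) − λ(b₊))`, the `U`-covariant differential of `λ` in the
left-trivialised reading), the right side to the `Ū^k(U)`-covariant COARSE differential of `λ∘emb^k`.  Consequences: (i) the infinitesimal residual gauge
transformations (`λ = 0` at the `k`-block centres) are kernel directions of `Q_k(U)` — the Lie-algebra shadow of the residual-orbit ∕ axial-tower statements of
[6] (1.15) (tree: `…N07AxialTowerRepresentative`, group level) and, with 35c's «kernel = fibre tangent», tangent to the fibre `{Ū^k = Ū^k(U)}`; (ii) at the flat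
background the linearised average maps a fine pure gauge `λ(b₋) − λ(b₊)` to the coarse pure gauge `λ(emb^k c₋) − λ(emb^k c₊)` (the `k`-fold, `Q_k(1)`-currency form of
`BlockAveragingEMLLinearised.linAvg_grad`; the route UnitScaleTilt's `ChartHInvComb.linFamily_grad` is the Summits-side twin for its `linFamily`, opposite sign convention).

CONTENTS (`M = M_N(ℂ)`; `Ad(g)Y = gYg⋆` = `specialUnitaryAd`; `emb^k = embIter k`; guard = 35b's `SmallBelow (fun j => blockAvg expMeanLogSU) k U`, at the record
`SmallBelow (avOfRecord F N K) k U`).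
* §1 `hasDerivAt_coe_expSU_smul` (`t ↦ ↑exp(t•Y)` has velocity `↑Y` at `0`) · ★ `hasDerivAt_iterM_fieldConj_family_of_one` — GUARD-FREE, every matrix field `V₀`, every family
  of site unitaries `w(t)` through `1` with velocities `ω`: `d∕dt iterM k (C_{w(t)}V₀)|_{t₀} (c) = ω(emb^k c₋)·(iterM k V₀)(c) − (iterM k V₀)(c)·ω(emb^k c₊)`.
* §2 ★★ `dIterL_apply_infGauge_of_differentiableAt` — wherever `iterM k` is differentiable at `V₀`:
  `Q_k(V₀)[b ↦ ↑λ(b₋)·V₀(b) − V₀(b)·↑λ(b₊)](c) = ↑λ(emb^k c₋)·(iterM k V₀)(c) − (iterM k V₀)(c)·↑λ(emb^k c₊)`; ★★ `dIterL_apply_infGauge` — on `SU(N)` data under the guard,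
  right side at `↑Ū^k(U)`.
* §3 `coe_mul_infGaugeDir` (`↑U_b·↑(Ad(U_b⁻¹)λ(b₋) − λ(b₊)) = ↑λ(b₋)·↑U_b − ↑U_b·↑λ(b₊)`) · ★★★ `qLin_infGauge` — THE ROW in print's left-trivialised reading:
  `qLin k U (b ↦ Ad(U_b⁻¹)λ(b₋) − λ(b₊)) c = ↑(Ad(Ū^k(U)_c⁻¹)λ(emb^k c₋)) − ↑λ(emb^k c₊)` · ★★ `qLin_infGauge_eq_zero_of_eq_zero_on_centres` (residual `λ` ⇒ kernel direction) ·
  `qLin_infGauge_const` (a global rotation `λ ≡ Λ₀`).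
* §4 flat background, NO guard: ★ `dIterL_one_apply_infGauge` · `qLin_one_infGauge` (`Q_k(1)(λ(b₋) − λ(b₊))(c) = λ(emb^k c₋) − λ(emb^k c₊)`) — also the non-vacuity witness of §2–§3's
  guard-shaped statements.
* §5 record twins `qLin_infGauge_avOfRecord` · `qLin_infGauge_eq_zero_of_eq_zero_on_centres_avOfRecord` (`avgFamily (avOfRecord F N K)`).

HONEST FRAMING: calculus∕algebra bookkeeping about the tree's own averaging map — one chain rule on g4's kernel-checked equivariance plus uniqueness of derivatives;
NO estimate of [15]∕[5]∕[7]; nothing of BRIDGE-92-B's rows (r0)–(r4); an unrequested completion of the D4 operator files, not a consumer's ask; N07 NOT discharged;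
K1⁷∕K0⁷ NOT closed; counts unmoved (typed 28∕28 · discharged 5∕27); one finite 𝕋⁴ programme at fixed ε — NOT continuum ∕ ℝ⁴ ∕ OS ∕ mass gap ∕ Clay (R4 closes the
conditional finite-𝕋⁴ rung `BalabanLadder.UV` only).  No `sorry`, no `def`, no `instance`, no `notation`.
-/

noncomputable section

namespace Literature.MathematicalPhysics.QuantumFieldTheory.Balaban1983to89.Node00

open Filter Topology
open T4Continuum BlockAveraging B15DeterminingSets
open ExpMeanLog (expMeanLogSU)
open T4AdjointCovarianceUnitary (lieSU expSU coe_expSU specialUnitaryAd coe_specialUnitaryAd)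
open B16Sect1Backgrounds (toMS)
open scoped Matrix.Norms.L2Operator

/-! ## §1  Gauge curves `exp(t·λ)` and the velocity of `t ↦ iterM k (C_{w(t)} V₀)` — guard-free -/

section Curves

variable {P : Params} {N : ℕ}

/-- **VELOCITY OF A ONE-PARAMETER SUBGROUP**: `t ↦ ↑exp(t•Y)` (`Y ∈ 𝔰𝔲(N)`) has derivative `↑Y` at `t = 0` (35a's `hasDerivAt_coe_expSU_along` along the line `t ↦ t•Y`).
[cite: Balaban1985BackgroundPropagators, (3.1)-(3.2) p.390 (bookkeeping: `u = exp(iηλ)` to first order)] -/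
theorem hasDerivAt_coe_expSU_smul (Y : lieSU (Fin N)) :
    HasDerivAt (fun t : ℝ => ((expSU (t • Y) : SU N) : Matrix (Fin N) (Fin N) ℂ)) (Y : Matrix (Fin N) (Fin N) ℂ) 0 := by
  have hfun : (fun t : ℝ => ((expSU (t • Y) : SU N) : Matrix (Fin N) (Fin N) ℂ)) =
      fun t : ℝ => NormedSpace.exp (t • (Y : Matrix (Fin N) (Fin N) ℂ)) :=
    funext fun t => by rw [coe_expSU, Submodule.coe_smul]
  rw [hfun]
  have h := hasDerivAt_exp_smul_const (Y : Matrix (Fin N) (Fin N) ℂ) (0 : ℝ)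
  rwa [zero_smul, NormedSpace.exp_zero, one_mul] at h

/-- ★ **THE VELOCITY OF THE ITERATE ALONG A MOVING INPUT CONJUGATION — GUARD-FREE, EVERY MATRIX FIELD**: if `t ↦ ↑(w t x)` has derivative `ω x` at `t₀` for every fine
site and `w t₀ = 1`, then `t ↦ iterM k (C_{w(t)} V₀)` has derivative `c ↦ ω(emb^k c₋)·(iterM k V₀)(c) − (iterM k V₀)(c)·ω(emb^k c₊)` at `t₀`.  Proof: by g4's two-sided
equivariance `iterM k (C_{w(t)} V₀) = C_{w(t)↾k}(iterM k V₀)` the family IS an OUTPUT conjugation of a constant field, differentiated by the product rule through `1`.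
[cite: Balaban1985Averaging, (8) p.18, (11) p.19; Balaban1987RG1, (0.21) p.256] -/
theorem hasDerivAt_iterM_fieldConj_family_of_one {k : ℕ} {w : ℝ → GaugeTransf P 0 (SU N)} {ω : Site P 0 → Matrix (Fin N) (Fin N) ℂ} {t₀ : ℝ}
    (hw : ∀ x : Site P 0, HasDerivAt (fun t : ℝ => ((w t x : SU N) : Matrix (Fin N) (Fin N) ℂ)) (ω x) t₀) (h1 : ∀ x, w t₀ x = 1)
    (V₀ : PBond P 0 → Matrix (Fin N) (Fin N) ℂ) :
    HasDerivAt (fun t : ℝ => iterM k (fieldConj (w t) V₀))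
      (fun c => ω (embIter k c.src) * iterM k V₀ c - iterM k V₀ c * ω (embIter k c.tgt)) t₀ := by
  have hfun : (fun t : ℝ => iterM k (fieldConj (w t) V₀)) = fun t : ℝ => fieldConj (toMS (w t) k) (iterM k V₀) :=
    funext fun t => iterM_fieldConj (w t) k V₀
  rw [hfun]
  have hw' : ∀ y : Site P k, HasDerivAt (fun t : ℝ => ((toMS (w t) k y : SU N) : Matrix (Fin N) (Fin N) ℂ)) (ω (embIter k y)) t₀ :=
    fun y => hw (embIter k y)
  have h1' : ∀ y : Site P k, toMS (w t₀) k y = 1 := fun y => h1 (embIter k y)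
  refine (hasDerivAt_fieldConj_family_of_one hw' h1' (hasDerivAt_const t₀ (iterM k V₀))).congr_deriv (funext fun c => ?_)
  simp only [Pi.zero_apply, zero_add]

end Curves

/-! ## §2  `Q_k(V₀)` on the chart direction of an infinitesimal gauge transformation of the INPUT -/

section Operator

variable {P : Params} {N : ℕ}

/-- ★★ **THE INFINITESIMAL GAUGE COVARIANCE OF `Q_k`, matrix level**: wherever 35b's `iterM k` is differentiable at `V₀` (e.g. under the guard, or at the flat
background), for every `λ : sites → 𝔰𝔲(N)`,
`Q_k(V₀)[b ↦ ↑λ(b₋)·V₀(b) − V₀(b)·↑λ(b₊)](c) = ↑λ(emb^k c₋)·(iterM k V₀)(c) − (iterM k V₀)(c)·↑λ(emb^k c₊)` — the derivative at `t = 0` of `Ū^k(U^{u(t)}) = (Ū^k U)^{u(t)↾k}`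
along `u(t) = exp(t·λ)`: chain rule on the left (`hasFDerivAt` of `iterM k` at `C_{u(0)}V₀ = V₀`), §1 on the right, uniqueness of derivatives.
[cite: Balaban1985Variational, (3)-(5) p.278, (44) p.285; Balaban1985Averaging, (11) p.19] -/
theorem dIterL_apply_infGauge_of_differentiableAt {k : ℕ} {V₀ : PBond P 0 → Matrix (Fin N) (Fin N) ℂ}
    (hd : DifferentiableAt ℝ (iterM k : (PBond P 0 → Matrix (Fin N) (Fin N) ℂ) → PBond P k → Matrix (Fin N) (Fin N) ℂ) V₀)
    (L : Site P 0 → lieSU (Fin N)) (c : PBond P k) :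
    dIterL k V₀ (fun b => (L b.src : Matrix (Fin N) (Fin N) ℂ) * V₀ b - V₀ b * (L b.tgt : Matrix (Fin N) (Fin N) ℂ)) c =
      (L (embIter k c.src) : Matrix (Fin N) (Fin N) ℂ) * iterM k V₀ c - iterM k V₀ c * (L (embIter k c.tgt) : Matrix (Fin N) (Fin N) ℂ) := by
  set w : ℝ → GaugeTransf P 0 (SU N) := fun t x => expSU (t • L x) with hw_def
  have hw : ∀ x : Site P 0, HasDerivAt (fun t : ℝ => ((w t x : SU N) : Matrix (Fin N) (Fin N) ℂ)) (L x : Matrix (Fin N) (Fin N) ℂ) 0 :=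
    fun x => hasDerivAt_coe_expSU_smul (L x)
  have h1 : ∀ x : Site P 0, w 0 x = 1 := fun x => by
    show expSU ((0 : ℝ) • L x) = 1
    rw [zero_smul, expSU_zero]
  have h0 : fieldConj (w 0) V₀ = V₀ := by
    funext b
    rw [fieldConj_apply, h1, h1, OneMemClass.coe_one, star_one, one_mul, mul_one]
  have hC : HasDerivAt (fun t : ℝ => fieldConj (w t) V₀)
      (fun b => (L b.src : Matrix (Fin N) (Fin N) ℂ) * V₀ b - V₀ b * (L b.tgt : Matrix (Fin N) (Fin N) ℂ)) 0 := by
    refine (hasDerivAt_fieldConj_family_of_one hw h1 (hasDerivAt_const (0 : ℝ) V₀)).congr_deriv (funext fun b => ?_)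
    simp only [Pi.zero_apply, zero_add]
  have hI : HasFDerivAt (iterM k : (PBond P 0 → Matrix (Fin N) (Fin N) ℂ) → PBond P k → Matrix (Fin N) (Fin N) ℂ) (dIterL k V₀) (fieldConj (w 0) V₀) := by
    rw [h0]
    exact hd.hasFDerivAt
  have hlhs : HasDerivAt (fun t : ℝ => iterM k (fieldConj (w t) V₀))
      (dIterL k V₀ (fun b => (L b.src : Matrix (Fin N) (Fin N) ℂ) * V₀ b - V₀ b * (L b.tgt : Matrix (Fin N) (Fin N) ℂ))) 0 :=
    hI.comp_hasDerivAt (0 : ℝ) hC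
  have hrhs := hasDerivAt_iterM_fieldConj_family_of_one (k := k) hw h1 V₀
  exact congrFun (hlhs.unique hrhs) c

variable [NeZero N]

/-- ★★ **ON `SU(N)` DATA UNDER 35b's GUARD BELOW `k`**: `Q_k(↑U)[b ↦ ↑λ(b₋)·↑U_b − ↑U_b·↑λ(b₊)](c) = ↑λ(emb^k c₋)·↑Ū^k(U)(c) − ↑Ū^k(U)(c)·↑λ(emb^k c₊)` — the chart direction
of the infinitesimal gauge transformation of `U` is mapped to that of `Ū^k(U)` with the block-centre values `λ∘emb^k` («`Ū^u = (Ū)^ū`» to first order in `u`).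
[cite: Balaban1985Variational, (3)-(5) p.278, (44) p.285; Balaban1985Averaging, (11) p.19; Balaban1987RG1, (0.4) p.253, (0.21) p.256] -/
theorem dIterL_apply_infGauge {U : GaugeField P 0 (SU N)} {k : ℕ} (h : SmallBelow (fun j => blockAvg (P := P) (j := j) expMeanLogSU) k U)
    (L : Site P 0 → lieSU (Fin N)) (c : PBond P k) :
    dIterL k (coeField U) (fun b => (L b.src : Matrix (Fin N) (Fin N) ℂ) * (U b : Matrix (Fin N) (Fin N) ℂ) -
        (U b : Matrix (Fin N) (Fin N) ℂ) * (L b.tgt : Matrix (Fin N) (Fin N) ℂ)) c =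
      (L (embIter k c.src) : Matrix (Fin N) (Fin N) ℂ) *
          ((Averaging.iter (fun j => blockAvg (P := P) (j := j) expMeanLogSU) k U c : SU N) : Matrix (Fin N) (Fin N) ℂ) -
        ((Averaging.iter (fun j => blockAvg (P := P) (j := j) expMeanLogSU) k U c : SU N) : Matrix (Fin N) (Fin N) ℂ) *
          (L (embIter k c.tgt) : Matrix (Fin N) (Fin N) ℂ) := by
  have hd : DifferentiableAt ℝ (iterM k : (PBond P 0 → Matrix (Fin N) (Fin N) ℂ) → PBond P k → Matrix (Fin N) (Fin N) ℂ) (coeField U) :=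
    (contDiffAt_iterM k h).differentiableAt (by simp)
  have hmain := dIterL_apply_infGauge_of_differentiableAt hd L c
  rw [← coeField_iter_eq_iterM k h] at hmain
  exact hmain

end Operator

/-! ## §3  Print's left-trivialised reading: `Q_k(U)(∇_U λ) = ∇_{Ū^k(U)}(λ∘emb^k)`; residual directions are kernel directions -/

section SUReading

variable {P : Params} {N : ℕ} [NeZero N]

omit [NeZero N] in
/-- **THE CHART DIRECTION OF AN INFINITESIMAL GAUGE TRANSFORMATION IS THE COVARIANT DIFFERENTIAL**: `↑U_b·↑(Ad(U_b⁻¹)λ(b₋) − λ(b₊)) = ↑λ(b₋)·↑U_b − ↑U_b·↑λ(b₊)` — in 35a's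
right chart `U·exp(X)` the tangent vector of `t ↦ U^{exp(tλ)}` is the 𝔰𝔲(N)-field `X_b = Ad(U_b⁻¹)λ(b₋) − λ(b₊)` (print's `−D_{U}λ` up to the `η`-scaling of (3.2)).
[cite: Balaban1985BackgroundPropagators, (3.1)-(3.2) p.390, (3.29) p.395; Balaban1985Averaging, (8) p.18] -/
theorem coe_mul_infGaugeDir (U : GaugeField P 0 (SU N)) (L : Site P 0 → lieSU (Fin N)) (b : PBond P 0) :
    (U b : Matrix (Fin N) (Fin N) ℂ) * ((specialUnitaryAd (U b)⁻¹ (L b.src) - L b.tgt : lieSU (Fin N)) : Matrix (Fin N) (Fin N) ℂ) =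
      (L b.src : Matrix (Fin N) (Fin N) ℂ) * (U b : Matrix (Fin N) (Fin N) ℂ) - (U b : Matrix (Fin N) (Fin N) ℂ) * (L b.tgt : Matrix (Fin N) (Fin N) ℂ) := by
  rw [Submodule.coe_sub, coe_specialUnitaryAd, coe_inv_SU, star_star, mul_sub, ← mul_assoc, ← mul_assoc, coe_mul_star_coe_SU, one_mul]

/-- ★★★ **THE INFINITESIMAL GAUGE COVARIANCE OF PRINT'S `Q_k(U₀)` (left-trivialised reading), under 35b's guard below `k`**: for every `λ : sites → 𝔰𝔲(N)`,
`qLin k U (b ↦ Ad(U_b⁻¹)λ(b₋) − λ(b₊)) (c) = ↑(Ad(Ū^k(U)(c)⁻¹) λ(emb^k c₋)) − ↑λ(emb^k c₊)` — «THE LINEARISED `k`-FOLD AVERAGE OF THE `U`-COVARIANT DIFFERENTIAL OF `λ` IS THE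
`Ū^k(U)`-COVARIANT COARSE DIFFERENTIAL OF `λ` RESTRICTED TO THE BLOCK CENTRES», the first-order content of `Ū^k(U^u) = (Ū^k U)^{ū}`, `ū = u∘emb^k`.
[cite: Balaban1985Variational, (3)-(5) p.278, (44) p.285, (82)-(83) p.290; Balaban1985Averaging, (11) p.19; Balaban1985BackgroundPropagators, (3.29) p.395] -/
theorem qLin_infGauge {U : GaugeField P 0 (SU N)} {k : ℕ} (h : SmallBelow (fun j => blockAvg (P := P) (j := j) expMeanLogSU) k U)
    (L : Site P 0 → lieSU (Fin N)) (c : PBond P k) :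
    qLin k U (fun b => specialUnitaryAd (U b)⁻¹ (L b.src) - L b.tgt) c =
      ((specialUnitaryAd (Averaging.iter (fun j => blockAvg (P := P) (j := j) expMeanLogSU) k U c)⁻¹ (L (embIter k c.src)) : lieSU (Fin N)) :
          Matrix (Fin N) (Fin N) ℂ) - (L (embIter k c.tgt) : Matrix (Fin N) (Fin N) ℂ) := by
  have hvel : (fun b => (U b : Matrix (Fin N) (Fin N) ℂ) * ((specialUnitaryAd (U b)⁻¹ (L b.src) - L b.tgt : lieSU (Fin N)) : Matrix (Fin N) (Fin N) ℂ)) =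
      fun b => (L b.src : Matrix (Fin N) (Fin N) ℂ) * (U b : Matrix (Fin N) (Fin N) ℂ) - (U b : Matrix (Fin N) (Fin N) ℂ) * (L b.tgt : Matrix (Fin N) (Fin N) ℂ) :=
    funext fun b => coe_mul_infGaugeDir U L b
  rw [qLin_apply, hvel, dIterL_apply_infGauge h L c, ← coeField_iter_eq_iterM k h, coeField_apply, mul_sub, ← mul_assoc, ← mul_assoc, star_coe_mul_coe_SU, one_mul,
    coe_specialUnitaryAd, coe_inv_SU, star_star]

/-- ★★ **INFINITESIMAL RESIDUAL GAUGE TRANSFORMATIONS ARE KERNEL DIRECTIONS OF `Q_k(U)`**: if `λ` vanishes at the `k`-block centres (`λ∘emb^k = 0` — the Lie algebra of the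
residual group «`u = 1` on `T₁^{(k)}`» of [15] p. 284 ∕ [6] (1.15)), then `Q_k(U)(∇_Uλ) = 0` (guard below `k`).  With 35c («kernel = fibre tangent») these directions are
tangent to the fibre `{Ū^k = Ū^k(U)}`, the Lie shadow of the residual orbit lying in the fibre. [cite: Balaban1985Variational, p.284, (82)-(83) p.290; Balaban1985RegularSpaces, (1.15) p.78] -/
theorem qLin_infGauge_eq_zero_of_eq_zero_on_centres {U : GaugeField P 0 (SU N)} {k : ℕ}
    (h : SmallBelow (fun j => blockAvg (P := P) (j := j) expMeanLogSU) k U) {L : Site P 0 → lieSU (Fin N)} (hL : ∀ y : Site P k, L (embIter k y) = 0) :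
    qLin k U (fun b => specialUnitaryAd (U b)⁻¹ (L b.src) - L b.tgt) = 0 := by
  funext c
  rw [qLin_infGauge h L c, hL, hL, map_zero, Submodule.coe_zero, sub_zero, Pi.zero_apply]

/-- **A GLOBAL ROTATION** `λ ≡ Λ₀`: `Q_k(U)(b ↦ Ad(U_b⁻¹)Λ₀ − Λ₀)(c) = ↑(Ad(Ū^k(U)(c)⁻¹)Λ₀) − ↑Λ₀` — constant gauge transformations commute with the averaging to first order
(the block-centre restriction of a constant is the constant). [cite: Balaban1985Averaging, (11) p.19; Balaban1985Variational, (3)-(5) p.278] -/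
theorem qLin_infGauge_const {U : GaugeField P 0 (SU N)} {k : ℕ} (h : SmallBelow (fun j => blockAvg (P := P) (j := j) expMeanLogSU) k U)
    (Λ₀ : lieSU (Fin N)) (c : PBond P k) :
    qLin k U (fun b => specialUnitaryAd (U b)⁻¹ Λ₀ - Λ₀) c =
      ((specialUnitaryAd (Averaging.iter (fun j => blockAvg (P := P) (j := j) expMeanLogSU) k U c)⁻¹ Λ₀ : lieSU (Fin N)) : Matrix (Fin N) (Fin N) ℂ) -
        (Λ₀ : Matrix (Fin N) (Fin N) ℂ) :=
  qLin_infGauge h (fun _ => Λ₀) c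

end SUReading

/-! ## §4  The flat background `U = 1` (no guard): fine pure gauges go to coarse pure gauges -/

section Flat

variable {P : Params} {N : ℕ}

/-- ★ **FLAT, matrix level, NO guard**: `Q_k(1)[b ↦ ↑λ(b₋) − ↑λ(b₊)](c) = ↑λ(emb^k c₋) − ↑λ(emb^k c₊)` — the linearised `k`-fold average at the trivial background maps the fine
pure gauge with parameter `λ` to the coarse pure gauge with parameter `λ∘emb^k` (the `k`-fold form of `BlockAveragingEMLLinearised.linAvg_grad`, here obtained from §2 at
`V₀ = 1` where `iterM k` is differentiable unconditionally, `hasFDerivAt_iterM_one`). [cite: Balaban1985Variational, (44),(47) p.285; Balaban1985Averaging, (11) p.19, (124) p.36] -/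
theorem dIterL_one_apply_infGauge (k : ℕ) (L : Site P 0 → lieSU (Fin N)) (c : PBond P k) :
    dIterL k (1 : PBond P 0 → Matrix (Fin N) (Fin N) ℂ) (fun b => (L b.src : Matrix (Fin N) (Fin N) ℂ) - (L b.tgt : Matrix (Fin N) (Fin N) ℂ)) c =
      (L (embIter k c.src) : Matrix (Fin N) (Fin N) ℂ) - (L (embIter k c.tgt) : Matrix (Fin N) (Fin N) ℂ) := by
  have hd : DifferentiableAt ℝ (iterM k : (PBond P 0 → Matrix (Fin N) (Fin N) ℂ) → PBond P k → Matrix (Fin N) (Fin N) ℂ) 1 :=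
    (hasFDerivAt_iterM_one (P := P) (N := N) k).differentiableAt
  have hmain := dIterL_apply_infGauge_of_differentiableAt hd L c
  simp only [Pi.one_apply, mul_one, one_mul, iterM_apply_one] at hmain
  exact hmain

variable [NeZero N]

/-- **FLAT, print's reading**: `qLin k 1 (b ↦ λ(b₋) − λ(b₊)) (c) = ↑λ(emb^k c₋) − ↑λ(emb^k c₊)` (at `U = 1` the direction `Ad(1)λ(b₋) − λ(b₊)` is `λ(b₋) − λ(b₊)` and `Ū^k(1) = 1`).
By g0's `qLin_one_eq_family` this is the statement for every `linAvg`-recursion family `Q^{(k)}` on these skew fields. [cite: Balaban1985Variational, (44),(47) p.285; Balaban1985Averaging, (124) p.36] -/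
theorem qLin_one_infGauge (k : ℕ) (L : Site P 0 → lieSU (Fin N)) (c : PBond P k) :
    qLin k (1 : GaugeField P 0 (SU N)) (fun b => L b.src - L b.tgt) c =
      (L (embIter k c.src) : Matrix (Fin N) (Fin N) ℂ) - (L (embIter k c.tgt) : Matrix (Fin N) (Fin N) ℂ) := by
  rw [qLin_one_apply]
  have hY : (fun b : PBond P 0 => ((L b.src - L b.tgt : lieSU (Fin N)) : Matrix (Fin N) (Fin N) ℂ)) =
      fun b => (L b.src : Matrix (Fin N) (Fin N) ℂ) - (L b.tgt : Matrix (Fin N) (Fin N) ℂ) := funext fun b => by rw [Submodule.coe_sub]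
  rw [hY]
  exact dIterL_one_apply_infGauge k L c

end Flat

/-! ## §5  At NODE 00's objects (`avOfRecord F N K j = blockAvg expMeanLogSU`, `rfl`) -/

section Record

variable {F : T4Family} {N : ℕ} [NeZero N]

/-- At the objects of record: `qLin k U (∇_Uλ) (c) = ↑(Ad(Ū^k(U)(c)⁻¹)λ(emb^k c₋)) − ↑λ(emb^k c₊)` for the record's `Ū^k = avgFamily (avOfRecord F N K) U k`, under
`SmallBelow (avOfRecord F N K) k U`. [cite: Balaban1985Variational, (3)-(5) p.278, (44) p.285; Balaban1988Convergent, (2.10)-(2.12) p.256] -/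
theorem qLin_infGauge_avOfRecord {K k : ℕ} {U : GaugeField (F.P K) 0 (SU N)} (h : SmallBelow (avOfRecord F N K) k U)
    (L : Site (F.P K) 0 → lieSU (Fin N)) (c : PBond (F.P K) k) :
    qLin k U (fun b => specialUnitaryAd (U b)⁻¹ (L b.src) - L b.tgt) c =
      ((specialUnitaryAd (avgFamily (avOfRecord F N K) U k c)⁻¹ (L (embIter k c.src)) : lieSU (Fin N)) : Matrix (Fin N) (Fin N) ℂ) -
        (L (embIter k c.tgt) : Matrix (Fin N) (Fin N) ℂ) :=
  qLin_infGauge h L c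

/-- At the objects of record: infinitesimal residual gauge transformations (`λ∘emb^k = 0`) are kernel directions of the record's `Q_k(U)`.
[cite: Balaban1985Variational, p.284, (82)-(83) p.290; Balaban1985RegularSpaces, (1.15) p.78] -/
theorem qLin_infGauge_eq_zero_of_eq_zero_on_centres_avOfRecord {K k : ℕ} {U : GaugeField (F.P K) 0 (SU N)} (h : SmallBelow (avOfRecord F N K) k U)
    {L : Site (F.P K) 0 → lieSU (Fin N)} (hL : ∀ y : Site (F.P K) k, L (embIter k y) = 0) :
    qLin k U (fun b => specialUnitaryAd (U b)⁻¹ (L b.src) - L b.tgt) = 0 :=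
  qLin_infGauge_eq_zero_of_eq_zero_on_centres h hL

end Record

end Literature.MathematicalPhysics.QuantumFieldTheory.Balaban1983to89.Node00
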